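import Literature.Computability.AlgebraicComplexity.Kron444HullCheck
import HarnessLib

/-!
# `Kron(4,4,4) ⊆ conv(328 vertices)`: certificate checks, part 8/14

Proofs file (computations only): the node checks of `Kron444HullCheck.lean` for the chunks
96 … 114 of the certificate, each decided by the kernel (`decide +kernel`; `maxHeartbeats 0`:
a chunk is ≈ 10⁵–10⁶ kernel reductions). Assembled in `Kron444Hull.lean`. [folklore]
-/

set_option Elab.async false

namespace Literature.Computability.AlgebraicComplexity.Kron444Hull

/-- Nodes `2400 … 2424` of the certificate (chunk `96`) pass `checkNodeRec`. [folklore] -/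
theorem checkChunk_96 : checkChunk 96 25 = true := by
  set_option maxHeartbeats 0 in decide +kernel

/-- Nodes `2425 … 2449` of the certificate (chunk `97`) pass `checkNodeRec`. [folklore] -/
theorem checkChunk_97 : checkChunk 97 25 = true := by
  set_option maxHeartbeats 0 in decide +kernel

/-- Nodes `2450 … 2474` of the certificate (chunk `98`) pass `checkNodeRec`. [folklore] -/
theorem checkChunk_98 : checkChunk 98 25 = true := by
  set_option maxHeartbeats 0 in decide +kernel

/-- Nodes `2475 … 2499` of the certificate (chunk `99`) pass `checkNodeRec`. [folklore] -/
theorem checkChunk_99 : checkChunk 99 25 = true := by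
  set_option maxHeartbeats 0 in decide +kernel

/-- Nodes `2500 … 2524` of the certificate (chunk `100`) pass `checkNodeRec`. [folklore] -/
theorem checkChunk_100 : checkChunk 100 25 = true := by
  set_option maxHeartbeats 0 in decide +kernel

/-- Nodes `2525 … 2549` of the certificate (chunk `101`) pass `checkNodeRec`. [folklore] -/
theorem checkChunk_101 : checkChunk 101 25 = true := by
  set_option maxHeartbeats 0 in decide +kernel

/-- Nodes `2550 … 2574` of the certificate (chunk `102`) pass `checkNodeRec`. [folklore] -/
theorem checkChunk_102 : checkChunk 102 25 = true := by
  set_option maxHeartbeats 0 in decide +kernel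

/-- Nodes `2575 … 2599` of the certificate (chunk `103`) pass `checkNodeRec`. [folklore] -/
theorem checkChunk_103 : checkChunk 103 25 = true := by
  set_option maxHeartbeats 0 in decide +kernel

/-- Nodes `2600 … 2624` of the certificate (chunk `104`) pass `checkNodeRec`. [folklore] -/
theorem checkChunk_104 : checkChunk 104 25 = true := by
  set_option maxHeartbeats 0 in decide +kernel

/-- Nodes `2625 … 2649` of the certificate (chunk `105`) pass `checkNodeRec`. [folklore] -/
theorem checkChunk_105 : checkChunk 105 25 = true := by
  set_option maxHeartbeats 0 in decide +kernel

/-- Nodes `2650 … 2674` of the certificate (chunk `106`) pass `checkNodeRec`. [folklore] -/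
theorem checkChunk_106 : checkChunk 106 25 = true := by
  set_option maxHeartbeats 0 in decide +kernel

/-- Nodes `2675 … 2699` of the certificate (chunk `107`) pass `checkNodeRec`. [folklore] -/
theorem checkChunk_107 : checkChunk 107 25 = true := by
  set_option maxHeartbeats 0 in decide +kernel

/-- Nodes `2700 … 2724` of the certificate (chunk `108`) pass `checkNodeRec`. [folklore] -/
theorem checkChunk_108 : checkChunk 108 25 = true := by
  set_option maxHeartbeats 0 in decide +kernel

/-- Nodes `2725 … 2749` of the certificate (chunk `109`) pass `checkNodeRec`. [folklore] -/
theorem checkChunk_109 : checkChunk 109 25 = true := by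
  set_option maxHeartbeats 0 in decide +kernel

/-- Nodes `2750 … 2774` of the certificate (chunk `110`) pass `checkNodeRec`. [folklore] -/
theorem checkChunk_110 : checkChunk 110 25 = true := by
  set_option maxHeartbeats 0 in decide +kernel

/-- Nodes `2775 … 2799` of the certificate (chunk `111`) pass `checkNodeRec`. [folklore] -/
theorem checkChunk_111 : checkChunk 111 25 = true := by
  set_option maxHeartbeats 0 in decide +kernel

/-- Nodes `2800 … 2824` of the certificate (chunk `112`) pass `checkNodeRec`. [folklore] -/
theorem checkChunk_112 : checkChunk 112 25 = true := by
  set_option maxHeartbeats 0 in decide +kernel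

/-- Nodes `2825 … 2849` of the certificate (chunk `113`) pass `checkNodeRec`. [folklore] -/
theorem checkChunk_113 : checkChunk 113 25 = true := by
  set_option maxHeartbeats 0 in decide +kernel

/-- Nodes `2850 … 2874` of the certificate (chunk `114`) pass `checkNodeRec`. [folklore] -/
theorem checkChunk_114 : checkChunk 114 25 = true := by
  set_option maxHeartbeats 0 in decide +kernel

end Literature.Computability.AlgebraicComplexity.Kron444Hull
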